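import Mathlib
import Summits.CriticalPhenomena.PercolationContinuityZ3.Theorems.PercNearOneGluingNoHeavyLowerTailReciprocalCMAllLevels
import HarnessLib

/-!
# THEOREM Φ (log-complete monotonicity): `m ↦ log ₂F₁(−θ,−(m+1);c;g) − log ₂F₁(−θ,−m;c;g)` is completely monotone

Support file for the Sahi / Conjecture-P programme of route `PercNearOneGluingNoHeavy`
(`--supports stmt-CriticalPhenomena-4575`, prover prim-l12-p5 gen 42; proof notes
`prim-l12-p5/PROOF-BRANCHING-DICTIONARY-g39.md` (4.3) and `PROOF-REGION-II-KUMMER-REFLECTION-g41.md` (2.3)).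
No definitions, no named facts, no sorries.

CONJECTURE Φ (g39): for every `θ > 0`, `c > 0`, `g ∈ [0,1)` the sequence `Δ_m log Q_θ(m)`, `Q_θ(m) = ₂F₁(−θ,−m;c;g)`, is completely
monotone — `Q_θ = e^B` with `B` discrete Bernstein, so `1/Q_θ` is LOG-CM (stronger than THEOREM H′).  In the birth–death language of g39:
`i ↦ −log E[e^{−sT_{i→i+1}}]` is completely monotone in the level `i`.  This file proves it in Region I (`c ≥ 1 − θ₀`, all `θ`)
and for all `θ ≤ 2` at every level, and isolates the induction step; `…LowerTailLogCMAll` adds Region II via THEOREM RII.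

* `altSum_pow_nonneg` — powers of a completely monotone sequence are completely monotone;
* **`altSum_logDiff_nonneg`** (LEMMA LOG) — if `f > 0` has completely monotone first difference then `m ↦ log f(m+1) − log f(m)`
  is completely monotone: `log f(m+1) − log f(m) = −log(1 − u_m) = Σ_{n≥1} u_m^n/n` with `u = Δf/f(·+1)` completely monotone;
* `hyp_logDiff_altSum_nonneg_le_one` (`θ ∈ (0,1]`, every `c > 0`: `Q_θ` itself is discrete Bernstein),
  `hyp_logDiff_altSum_nonneg_le_two` (`θ ∈ (1,2]`, every `c > 0`: `c·Q_θ = G·P_ϑ`, `hyp_G_factor`),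
  `hyp_logDiff_step` (`ρ_θ = Q_{θ−1}/Q_θ` CM and `Δlog Q_θ` CM ⟹ `Δlog Q_{θ+1}` CM, by Gauss' relation
  `(c+θ)Q_{θ+1} = (c + gm + θ(2−g) − θ(1−g)ρ_θ)·Q_θ`),
  **`hyp_logDiff_altSum_nonneg_regionI`** (`θ = θ₀ + n`, `c ≥ 1 − θ₀`: THEOREM Φ in Region I).
-/

namespace Summit.CriticalPhenomena.PercolationContinuityZ3.Theorems

namespace HypergeomCM

open Finset MomentRatioTN
open scoped Nat

/-! ### LEMMA LOG -/

/-- Powers of a completely monotone sequence are completely monotone (Leibniz). -/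
theorem altSum_pow_nonneg (u : ℕ → ℝ)
    (hu : ∀ k j, 0 ≤ ∑ i ∈ range (k + 1), (-1 : ℝ) ^ i * (k.choose i : ℝ) * u (j + i)) (n : ℕ) (k j : ℕ) :
    0 ≤ ∑ i ∈ range (k + 1), (-1 : ℝ) ^ i * (k.choose i : ℝ) * u (j + i) ^ (n + 1) := by
  induction n generalizing k j with
  | zero => simpa using hu k j
  | succ n ih =>
    have e : ∀ i : ℕ, u (j + i) ^ (n + 1 + 1) = u (j + i) ^ (n + 1) * u (j + i) := fun i => pow_succ _ _
    simp_rw [e]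
    exact altSum_mul_nonneg (fun m => u m ^ (n + 1)) u ih hu k j

/-- **LEMMA LOG.**  Let `f : ℕ → ℝ` be positive with completely monotone first difference (`f` "discrete Bernstein").  Then
`m ↦ log f(m+1) − log f(m)` is completely monotone; i.e. `f = e^B` with `B` discrete Bernstein.  Proof:
`log f(m+1) − log f(m) = −log(1 − u_m)` with `u_m = (f(m+1) − f(m))/f(m+1) ∈ [0,1)` completely monotone (LEMMA DB for `1/f(·+1)`,
Leibniz), and `−log(1−u) = Σ_{n≥1} u^n/n` is a positive combination of powers of `u`. -/
theorem altSum_logDiff_nonneg (f : ℕ → ℝ) (hf : ∀ r, 0 < f r)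
    (hΔ : ∀ k j, 0 ≤ ∑ i ∈ range (k + 1), (-1 : ℝ) ^ i * (k.choose i : ℝ) * (f (j + i + 1) - f (j + i)))
    (k j : ℕ) :
    0 ≤ ∑ i ∈ range (k + 1), (-1 : ℝ) ^ i * (k.choose i : ℝ) * (Real.log (f (j + i + 1)) - Real.log (f (j + i))) := by
  set u : ℕ → ℝ := fun m => (f (m + 1) - f m) * (f (m + 1))⁻¹ with hudef
  have hmono : ∀ m, f m ≤ f (m + 1) := by
    intro m
    have h := hΔ 0 m
    simp at h
    linarith
  have hu0 : ∀ m, 0 ≤ u m := fun m =>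
    mul_nonneg (sub_nonneg.2 (hmono m)) (inv_nonneg.2 (hf (m + 1)).le)
  have hu1 : ∀ m, u m < 1 := by
    intro m
    have h1 := hf m
    have h2 := hf (m + 1)
    have e : u m = 1 - f m / f (m + 1) := by
      simp only [hudef]
      field_simp
    rw [e]
    have : 0 < f m / f (m + 1) := div_pos h1 h2
    linarith
  have huabs : ∀ m, |u m| < 1 := fun m => by
    rw [abs_of_nonneg (hu0 m)]
    exact hu1 m
  -- u is completely monotone
  have huCM : ∀ k j, 0 ≤ ∑ i ∈ range (k + 1), (-1 : ℝ) ^ i * (k.choose i : ℝ) * u (j + i) := by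
    intro k j
    refine altSum_mul_nonneg (fun m => f (m + 1) - f m) (fun m => (f (m + 1))⁻¹) hΔ (fun k' j' => ?_) k j
    rw [altSum_shift (fun m => (f m)⁻¹) k' j']
    exact altSum_inv_nonneg f hf hΔ k' (j' + 1)
  -- the log difference as a power series in u
  have hlog : ∀ m, Real.log (f (m + 1)) - Real.log (f m) = -Real.log (1 - u m) := by
    intro m
    have h1 := hf m
    have h2 := hf (m + 1)
    have e : 1 - u m = f m / f (m + 1) := by
      simp only [hudef]
      field_simp
      ring
    rw [e, Real.log_div h1.ne' h2.ne']
    ring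
  have hseries : HasSum (fun n : ℕ => ∑ i ∈ range (k + 1),
      (-1 : ℝ) ^ i * (k.choose i : ℝ) * (u (j + i) ^ (n + 1) / (n + 1)))
      (∑ i ∈ range (k + 1), (-1 : ℝ) ^ i * (k.choose i : ℝ) * (-Real.log (1 - u (j + i)))) := by
    refine hasSum_sum fun i _ => ?_
    exact (Real.hasSum_pow_div_log_of_abs_lt_one (huabs (j + i))).mul_left _
  have e : ∀ i : ℕ, Real.log (f (j + i + 1)) - Real.log (f (j + i)) = -Real.log (1 - u (j + i)) :=
    fun i => hlog (j + i)
  simp_rw [e]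
  refine hseries.nonneg fun n => ?_
  have hn : ∑ i ∈ range (k + 1), (-1 : ℝ) ^ i * (k.choose i : ℝ) * (u (j + i) ^ (n + 1) / (n + 1)) =
      ((n : ℝ) + 1)⁻¹ * ∑ i ∈ range (k + 1), (-1 : ℝ) ^ i * (k.choose i : ℝ) * u (j + i) ^ (n + 1) := by
    rw [mul_sum]
    refine sum_congr rfl fun i _ => ?_
    rw [div_eq_mul_inv]
    ring
  rw [hn]
  exact mul_nonneg (inv_nonneg.2 (by positivity)) (altSum_pow_nonneg u huCM n k j)

/-! ### THEOREM Φ -/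

section

variable (g : ℝ) (H : ℝ → ℝ → ℕ → ℝ)
  (hH : ∀ a c r, H a c r = ∑ k ∈ range (r + 1), (r.choose k : ℝ) * (-g) ^ k *
    ((∏ i ∈ range k, (a + i)) / (∏ i ∈ range k, (c + i))))
include hH

/-- THEOREM Φ for `θ ∈ (0,1]` at every level `c > 0`: `Q_θ = H (−θ) c` is positive with completely monotone first difference
`(θg/c)·H (1−θ) (c+1)` (`hyp_step`, `hyp_altSum_nonneg`), so LEMMA LOG applies. -/
theorem hyp_logDiff_altSum_nonneg_le_one (hg0 : 0 ≤ g) (hg1 : g < 1) (c : ℝ) (hc : 0 < c) (θ : ℝ)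
    (h0 : 0 < θ) (h1 : θ ≤ 1) (k j : ℕ) :
    0 ≤ ∑ i ∈ range (k + 1), (-1 : ℝ) ^ i * (k.choose i : ℝ) *
      (Real.log (H (-θ) c (j + i + 1)) - Real.log (H (-θ) c (j + i))) := by
  have hP : ∀ r, 0 < H (-θ) c r := fun r => hyp_pos g H hH hg0 hg1 (-θ) r c hc (by linarith)
  have hΔ : ∀ r, H (-θ) c (r + 1) - H (-θ) c r = θ * g / c * H (1 - θ) (c + 1) r := by
    intro r
    have hs := hyp_step g H hH (-θ) c hc r
    rw [show -θ + 1 = 1 - θ by ring] at hs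
    field_simp
    linear_combination hs
  refine altSum_logDiff_nonneg (fun r => H (-θ) c r) hP (fun k j => ?_) k j
  simp_rw [hΔ]
  rw [altSum_const_mul]
  exact mul_nonneg (div_nonneg (mul_nonneg h0.le hg0) hc.le)
    (hyp_altSum_nonneg g H hH hg0 hg1 (1 - θ) (c + 1) (by linarith) (by linarith) (by linarith) k j)

/-- THEOREM Φ for `θ = ϑ+1 ∈ (1,2]` at every level `c > 0`: `c·Q_θ = G·P_ϑ` (`hyp_G_factor`) with `G` and `P_ϑ` positive with
completely monotone first differences (`hyp_G_pos`, `hyp_G_diff_altSum_nonneg`; `P_ϑ` at level `c+1`), so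
`Δlog Q_θ = Δlog G + Δlog P_ϑ` is completely monotone by LEMMA LOG twice. -/
theorem hyp_logDiff_altSum_nonneg_le_two (hg0 : 0 ≤ g) (hg1 : g < 1) (c : ℝ) (hc : 0 < c) (ϑ : ℝ)
    (h0 : 0 < ϑ) (h1 : ϑ ≤ 1) (k j : ℕ) :
    0 ≤ ∑ i ∈ range (k + 1), (-1 : ℝ) ^ i * (k.choose i : ℝ) *
      (Real.log (H (-ϑ - 1) c (j + i + 1)) - Real.log (H (-ϑ - 1) c (j + i))) := by
  have hQ : ∀ r, 0 < H (-ϑ - 1) c r := fun r => hyp_pos g H hH hg0 hg1 (-ϑ - 1) r c hc (by linarith)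
  have hP : ∀ r, 0 < H (-ϑ) (c + 1) r := fun r =>
    hyp_pos g H hH hg0 hg1 (-ϑ) r (c + 1) (by linarith) (by linarith)
  set G : ℕ → ℝ := fun r => c * H (-ϑ - 1) c r * (H (-ϑ) (c + 1) r)⁻¹ with hGdef
  have hGpos : ∀ r, 0 < G r := fun r => hyp_G_pos g H hH hg0 hg1 c hc ϑ h0 r
  -- log Q_θ(r) = log G(r) + log P_ϑ(r) − log c
  have hlogQ : ∀ r, Real.log (H (-ϑ - 1) c r) = Real.log (G r) + Real.log (H (-ϑ) (c + 1) r) - Real.log c := by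
    intro r
    have e : H (-ϑ - 1) c r = G r * H (-ϑ) (c + 1) r / c := by
      simp only [hGdef]
      have h1 := (hP r).ne'
      have h2 := hc.ne'
      field_simp
    rw [e, Real.log_div (mul_pos (hGpos r) (hP r)).ne' hc.ne', Real.log_mul (hGpos r).ne' (hP r).ne']
  have e : ∀ i : ℕ, Real.log (H (-ϑ - 1) c (j + i + 1)) - Real.log (H (-ϑ - 1) c (j + i)) =
      (Real.log (G (j + i + 1)) - Real.log (G (j + i))) +
        (Real.log (H (-ϑ) (c + 1) (j + i + 1)) - Real.log (H (-ϑ) (c + 1) (j + i))) := by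
    intro i
    rw [hlogQ (j + i + 1), hlogQ (j + i)]
    ring
  simp_rw [e]
  have hsplit : ∑ i ∈ range (k + 1), (-1 : ℝ) ^ i * (k.choose i : ℝ) *
      ((Real.log (G (j + i + 1)) - Real.log (G (j + i))) +
        (Real.log (H (-ϑ) (c + 1) (j + i + 1)) - Real.log (H (-ϑ) (c + 1) (j + i)))) =
      ∑ i ∈ range (k + 1), (-1 : ℝ) ^ i * (k.choose i : ℝ) * (Real.log (G (j + i + 1)) - Real.log (G (j + i))) +
        ∑ i ∈ range (k + 1), (-1 : ℝ) ^ i * (k.choose i : ℝ) *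
          (Real.log (H (-ϑ) (c + 1) (j + i + 1)) - Real.log (H (-ϑ) (c + 1) (j + i))) := by
    rw [← sum_add_distrib]
    refine sum_congr rfl fun i _ => ?_
    ring
  rw [hsplit]
  refine add_nonneg ?_ (hyp_logDiff_altSum_nonneg_le_one g H hH hg0 hg1 (c + 1) (by linarith) ϑ h0 h1 k j)
  refine altSum_logDiff_nonneg G hGpos (fun k' j' => ?_) k j
  have := hyp_G_diff_altSum_nonneg g H hH hg0 hg1 c hc ϑ h0 h1 k' j'
  simpa only [hGdef] using this

/-- **The induction step of THEOREM Φ** (g39 (4.3), g41 (2.3)).  Let `θ ≥ 0`, `c > 0`, `0 ≤ g < 1`.  If `ρ_θ = Q_{θ−1}/Q_θ` is completely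
monotone and `Δlog Q_θ` is completely monotone, then `Δlog Q_{θ+1}` is completely monotone: by Gauss' relation (`hyp_gauss`)
`(c+θ)·Q_{θ+1}(m) = V(m)·Q_θ(m)` with `V(m) = c + gm + θ(2−g) − θ(1−g)ρ_θ(m)` positive with completely monotone first difference
`g + θ(1−g)(ρ_θ(m) − ρ_θ(m+1))`, so `Δlog Q_{θ+1} = Δlog V + Δlog Q_θ` and LEMMA LOG applies to `V`. -/
theorem hyp_logDiff_step (hg0 : 0 ≤ g) (hg1 : g < 1) (c : ℝ) (hc : 0 < c) (θ : ℝ) (hθ : 0 ≤ θ)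
    (hρ : ∀ k j, 0 ≤ ∑ i ∈ range (k + 1), (-1 : ℝ) ^ i * (k.choose i : ℝ) *
      (H (1 - θ) c (j + i) * (H (-θ) c (j + i))⁻¹))
    (hΦ : ∀ k j, 0 ≤ ∑ i ∈ range (k + 1), (-1 : ℝ) ^ i * (k.choose i : ℝ) *
      (Real.log (H (-θ) c (j + i + 1)) - Real.log (H (-θ) c (j + i))))
    (k j : ℕ) :
    0 ≤ ∑ i ∈ range (k + 1), (-1 : ℝ) ^ i * (k.choose i : ℝ) *
      (Real.log (H (-θ - 1) c (j + i + 1)) - Real.log (H (-θ - 1) c (j + i))) := by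
  have hQ : ∀ r, 0 < H (-θ) c r := fun r => hyp_pos g H hH hg0 hg1 (-θ) r c hc (by linarith)
  have hQ1 : ∀ r, 0 < H (-θ - 1) c r := fun r => hyp_pos g H hH hg0 hg1 (-θ - 1) r c hc (by linarith)
  set ρ : ℕ → ℝ := fun r => H (1 - θ) c r * (H (-θ) c r)⁻¹ with hρdef
  set V : ℕ → ℝ := fun r => c + g * (r : ℝ) + θ * (2 - g) - θ * (1 - g) * ρ r with hVdef
  -- Gauss: (c+θ) Q_{θ+1}(r) = V(r) Q_θ(r)
  have hGauss : ∀ r : ℕ, (c + θ) * H (-θ - 1) c r = V r * H (-θ) c r := by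
    intro r
    have h := hyp_gauss g H hH r (-θ) c hc
    rw [show -θ + 1 = 1 - θ by ring] at h
    simp only [hVdef, hρdef]
    have h0' := (hQ r).ne'
    field_simp
    linear_combination h
  have hVpos : ∀ r, 0 < V r := by
    intro r
    have h := hGauss r
    have h1 : 0 < (c + θ) * H (-θ - 1) c r := mul_pos (by linarith) (hQ1 r)
    rw [h] at h1
    exact pos_of_mul_pos_left h1 (hQ r).le
  -- log Q_{θ+1}(r) = log V(r) + log Q_θ(r) − log(c+θ)
  have hlogQ : ∀ r, Real.log (H (-θ - 1) c r) = Real.log (V r) + Real.log (H (-θ) c r) - Real.log (c + θ) := by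
    intro r
    have hcθ : 0 < c + θ := by linarith
    have e : H (-θ - 1) c r = V r * H (-θ) c r / (c + θ) := by
      rw [← hGauss r]
      field_simp
    rw [e, Real.log_div (mul_pos (hVpos r) (hQ r)).ne' hcθ.ne', Real.log_mul (hVpos r).ne' (hQ r).ne']
  have e : ∀ i : ℕ, Real.log (H (-θ - 1) c (j + i + 1)) - Real.log (H (-θ - 1) c (j + i)) =
      (Real.log (V (j + i + 1)) - Real.log (V (j + i))) +
        (Real.log (H (-θ) c (j + i + 1)) - Real.log (H (-θ) c (j + i))) := by
    intro i
    rw [hlogQ (j + i + 1), hlogQ (j + i)]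
    ring
  simp_rw [e]
  have hsplit : ∑ i ∈ range (k + 1), (-1 : ℝ) ^ i * (k.choose i : ℝ) *
      ((Real.log (V (j + i + 1)) - Real.log (V (j + i))) +
        (Real.log (H (-θ) c (j + i + 1)) - Real.log (H (-θ) c (j + i)))) =
      ∑ i ∈ range (k + 1), (-1 : ℝ) ^ i * (k.choose i : ℝ) * (Real.log (V (j + i + 1)) - Real.log (V (j + i))) +
        ∑ i ∈ range (k + 1), (-1 : ℝ) ^ i * (k.choose i : ℝ) *
          (Real.log (H (-θ) c (j + i + 1)) - Real.log (H (-θ) c (j + i))) := by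
    rw [← sum_add_distrib]
    refine sum_congr rfl fun i _ => ?_
    ring
  rw [hsplit]
  refine add_nonneg (altSum_logDiff_nonneg V hVpos (fun k' j' => ?_) k j) (hΦ k j)
  -- ΔV = g + θ(1−g)(ρ(m) − ρ(m+1))
  have hΔV : ∀ i : ℕ, V (j' + i + 1) - V (j' + i) = g + θ * (1 - g) * (ρ (j' + i) - ρ (j' + i + 1)) := by
    intro i
    simp only [hVdef]
    push_cast
    ring
  simp_rw [hΔV]
  rw [altSum_const_add_mul g (θ * (1 - g)) (fun r => ρ r - ρ (r + 1)) k' j']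
  have hk : ∑ i ∈ range (k' + 1), (-1 : ℝ) ^ i * (k'.choose i : ℝ) * (ρ (j' + i) - ρ (j' + i + 1)) =
      ∑ i ∈ range (k' + 2), (-1 : ℝ) ^ i * ((k' + 1).choose i : ℝ) * ρ (j' + i) :=
    (altSum_succ ρ k' j').symm
  rw [hk]
  have hB := hρ (k' + 1) j'
  have : (0 : ℝ) ≤ (1 - 1) ^ k' := pow_nonneg (by norm_num) k'
  have hB0 : 0 ≤ θ * (1 - g) := mul_nonneg hθ (by linarith)
  positivity

/-- **THEOREM Φ in Region I.**  For `θ = θ₀ + n` (`θ₀ ∈ (0,1]`, `n ∈ ℕ`), `c > 0` with `c ≥ 1 − θ₀`, `0 ≤ g < 1`: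
`m ↦ log ₂F₁(−θ,−(m+1);c;g) − log ₂F₁(−θ,−m;c;g)` is completely monotone (base `hyp_logDiff_altSum_nonneg_le_one`; step
`hyp_logDiff_step` with `ρ_{θ₀+n}` CM from g37's `hyp_inv_altSum_aux'`). -/
theorem hyp_logDiff_altSum_nonneg_regionI (hg0 : 0 ≤ g) (hg1 : g < 1) (c : ℝ) (hc : 0 < c) (θ₀ : ℝ)
    (h0 : 0 < θ₀) (h1 : θ₀ ≤ 1) (hc1 : 1 - θ₀ ≤ c) (n : ℕ) (k j : ℕ) :
    0 ≤ ∑ i ∈ range (k + 1), (-1 : ℝ) ^ i * (k.choose i : ℝ) *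
      (Real.log (H (-(θ₀ + n)) c (j + i + 1)) - Real.log (H (-(θ₀ + n)) c (j + i))) := by
  induction n generalizing k j with
  | zero =>
    simp only [Nat.cast_zero, add_zero]
    exact hyp_logDiff_altSum_nonneg_le_one g H hH hg0 hg1 c hc θ₀ h0 h1 k j
  | succ n ih =>
    have hρ := (hyp_inv_altSum_aux' g H hH hg0 hg1 c hc θ₀ h0 h1 hc1 n).2
    have hstep := hyp_logDiff_step g H hH hg0 hg1 c hc (θ₀ + n) (by positivity) hρ ih k j
    have e1 : -(θ₀ + (n : ℝ)) - 1 = -(θ₀ + ((n + 1 : ℕ) : ℝ)) := by push_cast; ring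
    rw [e1] at hstep
    exact hstep

end

end HypergeomCM

end Summit.CriticalPhenomena.PercolationContinuityZ3.Theorems
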